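import Literature.Probability.Percolation.TwoSetExchange
import HarnessLib

/-!
# Pair attachment versus separated attachment (hull-port pattern row from
# van den Berg–Häggström–Kahn 2006, Thm. 1.3 / Thm. 2.1 with a SOURCE SET)

Topic `Literature/Probability/Percolation`.  Companion of `LonePortSum.lean` (the loner row
`lonerAttachment_glued_le_sep`: the rate at which a vertex `v` attaches to a LONE port `p₃` in the
world "`p₁p₂` glued, `p₃` alone" is at most its rate in the world "all three ports separate").  Here
the PAIR row, in the opposite direction: the rate at which `v` attaches to the glued pair `{p₁, p₂}`
in the world "`p₁p₂` glued, `p₃` alone" is AT LEAST the rate at which `v` attaches to `{p₁, p₂}` in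
the world "all separate":

* `pairAttachment_ge_sepRate` — with `D = {p₃ ↮ p₁} ∩ {p₃ ↮ p₂}` ("`p₃` alone"),
  `O₁₂ = {p₁ ↔ v} ∪ {p₂ ↔ v}`:
  `μ(D ∩ {p₁↮p₂} ∩ O₁₂) · μ(D ∩ {p₁↔p₂}) ≤ μ(D ∩ {p₁↔p₂} ∩ O₁₂) · μ(D ∩ {p₁↮p₂})`,
  i.e. in the 15-pattern coordinates of the three-port hull-port line (ttrl t3lp §1)
  `(x11 + x12) · G12 ≤ x2 · S`:  `P(v ↔ {p₁,p₂} | Sep) ≤ P(v ↔ {p₁,p₂} | 12|3)`.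

It is the event form of BHK's Theorem 1.3 with the source `s` replaced by the SET `S = {p₁, p₂}`
(Remark 1 after Thm. 1.2; = Thm. 2.1 at `q = 1` for two events increasing in `C_S`), conditioned on
`{S ↮ p₃}`: the events `{S ↔ v}` and `{p₁ ↔ p₂}` are both increasing in `C_S = C_{p₁} ∪ C_{p₂}`,
hence positively correlated given `{S ↮ p₃}` — obtained here from the tree's event form
`setTwoClusterExchange` (with the two type-`(−)` events trivial).  Not stated in print in this
form; derived in this file.  It is one of the "set-source" rows that the degree-3 certificates of
the three-port exchange `(T_3)` need beyond Harris' inequality (prim-lit-3 LITERATURE-3 §2L–2M,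
prim-lit-4 LITERATURE-4 §D7(d), family `pT2`).

## References

* J. van den Berg, O. Häggström, J. Kahn, *Some conditional correlation inequalities for
  percolation and related processes*, Random Structures Algorithms 29 (2006) 417–435
  (arXiv:math/0408176), Thm. 1.3 (p. 6), Remark 1 after Thm. 1.2 (p. 5), Thm. 2.1 (p. 9).
  [VandenbergHaggstromKahn2005]
* G. Grimmett, *Percolation*, 2nd ed., Springer 1999, §2.2 (Harris–FKG). [Grimmett1999]
-/

noncomputable section

open MeasureTheory Set
open Literature.Probability.LatticeModels (prodBernoulli)

namespace Literature.Probability.Percolation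

variable {V : Type*}

namespace PairAttachmentSepRate

/-- The separation event `{S ↮ T}` of `setTwoClusterExchange` for `S = {p₁, p₂}`, `T = {p₃}` is
`{p₁ ↮ p₃} ∩ {p₂ ↮ p₃}`. [folklore] -/
theorem sep_pair_singleton_eq (p₁ p₂ p₃ : V) :
    {ω : BondConfig V | ∀ s ∈ ({p₁, p₂} : Set V), ∀ t ∈ ({p₃} : Set V),
        ¬ (openGraph ω).Reachable s t} =
      ((openConn p₁ p₃)ᶜ ∩ (openConn p₂ p₃)ᶜ : Set (BondConfig V)) := by
  ext ω
  simp only [mem_setOf_eq, mem_insert_iff, mem_singleton_iff, forall_eq_or_imp, forall_eq,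
    mem_inter_iff, mem_compl_iff]
  rfl

/-- Positive association of two type-`(+)` events given `{S ↮ T}` (event form of BHK Thm. 2.1 at
`q = 1` for events increasing in `C_S` and decreasing in `C_T`):
`μ(D ∩ A₁) · μ(D ∩ A₂) ≤ μ(D ∩ (A₁ ∩ A₂)) · μ(D)` — the case `B₁ = B₂ = univ` of
`setTwoClusterExchange`.
[cite: VandenbergHaggstromKahn2005, Thm. 2.1 (p. 9) at q = 1 — corollary, derived in this file] -/
theorem typePlus_posAssoc [Fintype V] (w : Sym2 V → unitInterval) (S T : Set V)
    {A₁ A₂ : Set (BondConfig V)}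
    (hA₁ : ∀ ⦃ω ω' : BondConfig V⦄, (⋃ s ∈ S, openEdgeCluster ω s) ⊆ (⋃ s ∈ S, openEdgeCluster ω' s) →
      (⋃ t ∈ T, openEdgeCluster ω' t) ⊆ (⋃ t ∈ T, openEdgeCluster ω t) → ω ∈ A₁ → ω' ∈ A₁)
    (hA₂ : ∀ ⦃ω ω' : BondConfig V⦄, (⋃ s ∈ S, openEdgeCluster ω s) ⊆ (⋃ s ∈ S, openEdgeCluster ω' s) →
      (⋃ t ∈ T, openEdgeCluster ω' t) ⊆ (⋃ t ∈ T, openEdgeCluster ω t) → ω ∈ A₂ → ω' ∈ A₂) :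
    (prodBernoulli w).real ({ω : BondConfig V | ∀ s ∈ S, ∀ t ∈ T, ¬ (openGraph ω).Reachable s t} ∩
        A₁) *
      (prodBernoulli w).real ({ω : BondConfig V | ∀ s ∈ S, ∀ t ∈ T, ¬ (openGraph ω).Reachable s t} ∩
        A₂) ≤
    (prodBernoulli w).real ({ω : BondConfig V | ∀ s ∈ S, ∀ t ∈ T, ¬ (openGraph ω).Reachable s t} ∩
        (A₁ ∩ A₂)) *
      (prodBernoulli w).real {ω : BondConfig V | ∀ s ∈ S, ∀ t ∈ T, ¬ (openGraph ω).Reachable s t} := by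
  have key := setTwoClusterExchange w S T (A₁ := A₁) (A₂ := A₂) (B₁ := Set.univ) (B₂ := Set.univ)
    hA₁ hA₂ (fun _ _ _ _ _ => mem_univ _) (fun _ _ _ _ _ => mem_univ _)
  simpa only [inter_univ, univ_inter] using key

end PairAttachmentSepRate

open PairAttachmentSepRate TwoSetExchange in
/-- **Pair attachment versus separated attachment (quadratic pattern inequality).**  For ports
`p₁, p₂, p₃`, a vertex `v`, `D = {p₁ ↮ p₃} ∩ {p₂ ↮ p₃}` ("`p₃` alone") and
`O₁₂ = {p₁ ↔ v} ∪ {p₂ ↔ v}`: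
`μ(D ∩ {p₁↮p₂} ∩ O₁₂) · μ(D ∩ {p₁↔p₂}) ≤ μ(D ∩ {p₁↔p₂} ∩ O₁₂) · μ(D ∩ {p₁↮p₂})` — in the pattern
coordinates of the hull-port line `(x11 + x12) · G12 ≤ x2 · S`, i.e.
`P(v ↔ {p₁,p₂} | all separate) ≤ P(v ↔ {p₁,p₂} | p₁p₂ glued, p₃ alone)`.
Proof: `{S ↔ v}` and `{p₁ ↔ p₂}` are increasing in `C_S`, `S = {p₁,p₂}`
(`typePlus_openConn_of_mem`), so they are positively correlated given `{S ↮ p₃}`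
(`typePlus_posAssoc`); then split `D` along `{p₁ ↔ p₂}`.  Not in print; derived here.
[cite: VandenbergHaggstromKahn2005, Thm. 1.3 (p. 6) with Remark 1 after Thm. 1.2 (p. 5) — corollary, derived in this file] -/
theorem pairAttachment_ge_sepRate [Fintype V] (w : Sym2 V → unitInterval) (v p₁ p₂ p₃ : V) :
    (prodBernoulli w).real ((openConn p₁ p₃)ᶜ ∩ (openConn p₂ p₃)ᶜ ∩ (openConn p₁ p₂)ᶜ ∩
        (openConn p₁ v ∪ openConn p₂ v) : Set (BondConfig V)) *
      (prodBernoulli w).real ((openConn p₁ p₃)ᶜ ∩ (openConn p₂ p₃)ᶜ ∩ openConn p₁ p₂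
        : Set (BondConfig V)) ≤
    (prodBernoulli w).real ((openConn p₁ p₃)ᶜ ∩ (openConn p₂ p₃)ᶜ ∩ openConn p₁ p₂ ∩
        (openConn p₁ v ∪ openConn p₂ v) : Set (BondConfig V)) *
      (prodBernoulli w).real ((openConn p₁ p₃)ᶜ ∩ (openConn p₂ p₃)ᶜ ∩ (openConn p₁ p₂)ᶜ
        : Set (BondConfig V)) := by
  set μ := prodBernoulli w with hμ
  set D : Set (BondConfig V) := (openConn p₁ p₃)ᶜ ∩ (openConn p₂ p₃)ᶜ with hD
  set O : Set (BondConfig V) := openConn p₁ v ∪ openConn p₂ v with hO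
  set E : Set (BondConfig V) := openConn p₁ p₂ with hE
  have hp₁ : p₁ ∈ ({p₁, p₂} : Set V) := mem_insert p₁ {p₂}
  have hp₂ : p₂ ∈ ({p₁, p₂} : Set V) := mem_insert_of_mem p₁ rfl
  -- `O` and `E` are of type `(+)` for `S = {p₁, p₂}`, `T = {p₃}`
  have hOplus : ∀ ⦃ω ω' : BondConfig V⦄,
      (⋃ s ∈ ({p₁, p₂} : Set V), openEdgeCluster ω s) ⊆ (⋃ s ∈ ({p₁, p₂} : Set V), openEdgeCluster ω' s) →
      (⋃ t ∈ ({p₃} : Set V), openEdgeCluster ω' t) ⊆ (⋃ t ∈ ({p₃} : Set V), openEdgeCluster ω t) →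
      ω ∈ O → ω' ∈ O := by
    intro ω ω' hs ht hω
    rcases hω with h | h
    · exact Or.inl (typePlus_openConn_of_mem {p₁, p₂} {p₃} hp₁ v hs ht h)
    · exact Or.inr (typePlus_openConn_of_mem {p₁, p₂} {p₃} hp₂ v hs ht h)
  have hEplus : ∀ ⦃ω ω' : BondConfig V⦄,
      (⋃ s ∈ ({p₁, p₂} : Set V), openEdgeCluster ω s) ⊆ (⋃ s ∈ ({p₁, p₂} : Set V), openEdgeCluster ω' s) →
      (⋃ t ∈ ({p₃} : Set V), openEdgeCluster ω' t) ⊆ (⋃ t ∈ ({p₃} : Set V), openEdgeCluster ω t) →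
      ω ∈ E → ω' ∈ E :=
    fun ω ω' hs ht hω => typePlus_openConn_of_mem {p₁, p₂} {p₃} hp₁ p₂ hs ht hω
  have key := typePlus_posAssoc w ({p₁, p₂} : Set V) ({p₃} : Set V) hOplus hEplus
  rw [sep_pair_singleton_eq] at key
  -- key : μ(D ∩ O) * μ(D ∩ E) ≤ μ(D ∩ (O ∩ E)) * μ(D)
  have hm : MeasurableSet E := MeasurableSet.of_discrete
  have sO : μ.real (D ∩ O) = μ.real ((D ∩ O) ∩ E) + μ.real ((D ∩ O) \ E) :=
    (measureReal_inter_add_sdiff hm).symm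
  have sD : μ.real D = μ.real (D ∩ E) + μ.real (D \ E) := (measureReal_inter_add_sdiff hm).symm
  have e1 : D ∩ (O ∩ E) = D ∩ E ∩ O := by
    rw [← inter_assoc, inter_right_comm]
  have e2 : (D ∩ O) ∩ E = D ∩ E ∩ O := inter_right_comm D O E
  have e3 : (D ∩ O) \ E = D ∩ Eᶜ ∩ O := by rw [sdiff_eq, inter_right_comm]
  have e4 : D \ E = D ∩ Eᶜ := sdiff_eq
  rw [e1] at key
  rw [e2, e3] at sO
  rw [e4] at sD
  rw [sO, sD] at key
  have h0 : 0 ≤ μ.real (D ∩ E ∩ O) := measureReal_nonneg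
  have h1 : 0 ≤ μ.real (D ∩ E) := measureReal_nonneg
  -- (a + b) G ≤ a (G + S)  ⟹  b G ≤ a S
  nlinarith [key]


end Literature.Probability.Percolation
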